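import Mathlib.Algebra.Polynomial.Div
import Mathlib.LinearAlgebra.BilinearMap
import Mathlib.Tactic.LinearCombination
import Mathlib.Tactic.Ring
import HarnessLib

/-!
# BirchSwinnertonDyer — rank-2 `Ш[p^∞]` cell, STRUCTURE track: the K-side height to second order (T18a/T18b/T18c)

HONEST FRAMING (cell `b2b-bsdr2sha`, run/shared/lean/b2b/bsd-rank2-sha/, structure/THEORY-NOTE-C5.md
supplement 18, (18.6) «TYPING TARGETS T18a / T18b / T18c»): ELEMENTARY commutative algebra — congruences modulo
`p²` / `p³` in an arbitrary commutative ring, one polynomial identity modulo `t³`, and the polarisation identity for a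
symmetric bilinear form. Nothing here concerns BSD, `Ш`, `L`-values, or any census number, and nothing here ASSERTS
anything about `p`-adic heights: every height-theoretic input of supplement 18 (the Mazur–Stein–Tate formula
`h_H(Q_K)/p = (2/n′²)(L_U + L_S)`, the `σ`-function expansion `σ(t)/t = 1 + (a₁/2)t + c₂t² + O(t³)`, the value
`c₂ = (a₁² + a₂)/3 + E₂/24`, the convergence of `log_p`, and the data-side reconstruction) stays OUTSIDE this file and
enters only as named hypotheses on ring elements. No definition, no named fact, no axiom. Companion of
`Rank2ShaFermatQuotientLog` (T15) and `Rank2ShaLogTranslation` (T17).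

WHAT IS TYPED.
* (T18a) THE SECOND-ORDER UNIT-LOG STEP (18.2(a)). With `u^{p−1} = 1 + p·F` and `log_p u = log_p(u^{p−1})/(p − 1)`,
  the truncated logarithm gives `2(p − 1)·L ≡ 2F − p·F² (mod p²)` for `L := log_p(u)/p` (the analytic input, taken
  as the HYPOTHESIS `hL`); the ring step typed here is the inversion of `p − 1` modulo `p²` via `(p − 1)(−1 − p) = 1 − p²`:
  **`2L ≡ −2F − 2p·F + p·F² (mod p²)`**, i.e. `L ≡ −F − pF + pF²/2` [`sq_dvd_two_mul_unitLog_sub`]; and the source of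
  `hL` as a polynomial truncation: `2·(pF − (pF)²/2) = p·(2F − pF²)` exactly, the cubic tail being `O(p³)`
  [`cube_dvd_truncLog₂_sub`].
* (T18b) THE `σ`-QUOTIENT LOG TO ORDER `t²` (18.2(b)). For `g = α·t + β·t² + t³·r` (any tail `r`):
  `2g − g² ≡ 2α·t + (2β − α²)·t² (mod t³)` — the `t²`-coefficient of the truncated log `g − g²/2` of
  `s = 1 + αt + βt² + O(t³)` is `β − α²/2` [`X_pow_three_dvd_truncLog_sub` (polynomial form), `cube_dvd_truncLog_eval_sub`
  (evaluated at `t = p·t₁`, giving `L_S ≡ α·t₁ + p(β − α²/2)·t₁² (mod p²)` after one division by `p`, kept multiplied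
  through), `cube_dvd_truncLog_eval_sub_of_level_two` (at `t = p²·t₂`: `L_S ≡ p·α·t₂`)]; and the coefficient
  arithmetic `2α = a₁`, `24β = 8(a₁² + a₂) + E₂` ⟹ `24(2β − α²) = 2(5a₁² + 8a₂ + E₂)` [`coeff_identity_E₂`] — the
  `(5a₁² + 8a₂ + E₂)/24` of (18.2), with `a₁, a₂, E₂, α, β` free ring elements (nothing about `E₂` is computed here).
* (T18c) THE RECONSTRUCTION LEMMA 18.1 as linear algebra: for a bilinear form `B` on an `R`-module with `B` symmetric,
  `B(mP − P_o, mP − P_o) = m²·B(P,P) + B(P_o,P_o) − 2m·B(P,P_o)` [`bilin_apply_smul_sub_self`] (18.1(iii)); the polar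
  form of the rank-one quadratic form `X ↦ D·ℓ(X)²` is `D·ℓ(X)ℓ(Y)`: `D·ℓ(X+Y)² − D·ℓ(X)² − D·ℓ(Y)² = 2·D·ℓ(X)·ℓ(Y)`
  [`polar_rank_one`] (18.1(ii)); the Gram rearrangement `Reg = h·h_o − s² ⟹ s² = h·h_o − Reg` [`gram_offdiag_sq`]
  (18.1(i)); and the POLE CANCELLATION of 18.1(iii): if `A ≡ D`, `A_o ≡ m²·D`, `C ≡ m·D (mod p)` (pole digits of
  `p·h(P)`, `p·h(P_o)`, `p·s` for the rank-one polar part with `ℓ(P) = 1`, `ℓ(P_o) = m`) then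
  `m²·A + A_o − 2m·C ≡ 0 (mod p)` [`dvd_pole_cancel`] — `h_H(Q_K)` has no `p⁻¹` term.

References: the cell's THEORY-NOTE-C5.md supplement 18 (LEAD g10, 2026-08-24T12:01Z); T15 = `Rank2ShaFermatQuotientLog`
(p376124), T17 = `Rank2ShaLogTranslation` (p379175).
-/

set_option autoImplicit false

-- single-conjunct summit: `Summit.BirchSwinnertonDyer.BirchSwinnertonDyer.…` repeats the name by design
set_option linter.dupNamespace false

open Polynomial

namespace Summit.BirchSwinnertonDyer.BirchSwinnertonDyer.Rank2Sha.Structure.KHeightSecondOrder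

section Ring

variable {R : Type*} [CommRing R]

/-! ### T18a — the second-order unit-log step -/

/-- **(18.2)(a), the ring step.** If `2(p − 1)·L ≡ 2F − p·F² (mod p²)` (the truncated logarithm of `u^{p−1} = 1 + pF`,
divided by `p`; analytic input) then **`2L ≡ −2F − 2p·F + p·F² (mod p²)`**, i.e. `L ≡ −F − pF + pF²/2 (mod p²)`:
multiply by `−1 − p` and use `(p − 1)(−1 − p) = 1 − p²`. -/
theorem sq_dvd_two_mul_unitLog_sub (p F L : R) (hL : p ^ 2 ∣ 2 * (p - 1) * L - (2 * F - p * F ^ 2)) :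
    p ^ 2 ∣ 2 * L - (-2 * F - 2 * p * F + p * F ^ 2) := by
  obtain ⟨c, hc⟩ := hL
  exact ⟨2 * L + F ^ 2 - c * (1 + p), by linear_combination (-1 - p) * hc⟩

/-- **Source of the hypothesis of `sq_dvd_two_mul_unitLog_sub` as a polynomial truncation.** The degree-two
truncation of `2·log(1 + y)` is `2y − y²`; at `y = p·F` it equals `p·(2F − p·F²)` EXACTLY, and the first omitted term
`2y³/3` is `O(p³)`. Typed: for any `ρ` (the tail `Σ_{j≥3}` divided by `p³`, an analytic input),
`(2·(pF) − (pF)² + p³·ρ) − p·(2F − pF²) = p³·ρ`, so `p³` divides the difference. -/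
theorem cube_dvd_truncLog₂_sub (p F ρ : R) :
    p ^ 3 ∣ (2 * (p * F) - (p * F) ^ 2 + p ^ 3 * ρ) - p * (2 * F - p * F ^ 2) :=
  ⟨ρ, by ring⟩

/-- The same one level down (what `hL` of `sq_dvd_two_mul_unitLog_sub` abbreviates): if
`2(p−1)·(p·L) ≡ 2·(pF) − (pF)² (mod p³)` and `p` may be cancelled from `p³ ∣ p·w` (hypothesis `hreg`, automatic in
`ℤ`, `ℤ_p`), then `2(p−1)·L ≡ 2F − pF² (mod p²)`. -/
theorem sq_dvd_unitLog_hyp_of_cube (p F L : R) (hreg : ∀ w : R, p ^ 3 ∣ p * w → p ^ 2 ∣ w)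
    (h : p ^ 3 ∣ 2 * (p - 1) * (p * L) - (2 * (p * F) - (p * F) ^ 2)) :
    p ^ 2 ∣ 2 * (p - 1) * L - (2 * F - p * F ^ 2) := by
  refine hreg _ ?_
  obtain ⟨c, hc⟩ := h
  exact ⟨c, by linear_combination hc⟩

/-! ### T18b — the `σ`-quotient logarithm to order `t²` -/

/-- **Truncated log to order `t²`, polynomial form.** For `g = α·X + β·X² + X³·r` (any polynomial tail `r`):
`X³ ∣ (2g − g²) − (2α·X + (2β − α²)·X²)` — the `X²`-coefficient of `g − g²/2` is `β − α²/2` (18.6 (T18b);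
`α = a₁/2`, `β = c₂` are hypotheses of the note, not computed here). -/
theorem X_pow_three_dvd_truncLog_sub (α β : R) (r : R[X]) :
    (X : R[X]) ^ 3 ∣ (2 * (C α * X + C β * X ^ 2 + X ^ 3 * r) - (C α * X + C β * X ^ 2 + X ^ 3 * r) ^ 2) -
      (C (2 * α) * X + C (2 * β - α ^ 2) * X ^ 2) :=
  ⟨2 * r - (2 * C α * C β + C β ^ 2 * X + 2 * (C α + C β * X) * X * r + X ^ 3 * r ^ 2), by
    simp only [map_mul, map_sub, map_pow, map_ofNat]
    ring⟩

/-- **Truncated log to order `t²`, evaluated at level one `t = p·t₁`** (18.2(b), `k = 1`). For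
`G = α·(p t₁) + β·(p t₁)² + (p t₁)³·ρ` (the value of `σ(t)/t − 1` with any tail):
`p³ ∣ (2G − G²) − p·(2α·t₁ + p·(2β − α²)·t₁²)` — i.e. `2·L_S ≡ 2α·t₁ + p(2β − α²)·t₁² (mod p²)` for `p·L_S = log(σ(t)/t)`
truncated, the displayed `L_S ≡ (a₁/2)t₁ + p·((5a₁² + 8a₂ + E₂)/24)·t₁²` once `α, β` are specialised (`coeff_identity_E₂`). -/
theorem cube_dvd_truncLog_eval_sub (p α β t₁ ρ : R) :
    p ^ 3 ∣ (2 * (α * (p * t₁) + β * (p * t₁) ^ 2 + (p * t₁) ^ 3 * ρ) -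
        (α * (p * t₁) + β * (p * t₁) ^ 2 + (p * t₁) ^ 3 * ρ) ^ 2) -
      p * (2 * α * t₁ + p * (2 * β - α ^ 2) * t₁ ^ 2) :=
  ⟨t₁ ^ 3 * (2 * ρ - (2 * α * β + β ^ 2 * (p * t₁) + 2 * (α + β * (p * t₁)) * (p * t₁) * ρ +
      (p * t₁) ^ 3 * ρ ^ 2)), by ring⟩

/-- **Level two, `t = p²·t₂`** (18.2(b), `k = 2`): for `G = α·(p²t₂) + (p²t₂)²·ρ` (any tail),
`p³ ∣ (2G − G²) − p·(2·p·α·t₂)`, i.e. `L_S ≡ p·α·t₂ (mod p²)`. (For `k ≥ 3`, `G ∈ p³R` and `L_S ≡ 0 (mod p²)`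
trivially.) -/
theorem cube_dvd_truncLog_eval_sub_of_level_two (p α t₂ ρ : R) :
    p ^ 3 ∣ (2 * (α * (p ^ 2 * t₂) + (p ^ 2 * t₂) ^ 2 * ρ) - (α * (p ^ 2 * t₂) + (p ^ 2 * t₂) ^ 2 * ρ) ^ 2) -
      p * (2 * p * α * t₂) :=
  ⟨p * t₂ ^ 2 * (2 * ρ - (α + p ^ 2 * t₂ * ρ) ^ 2), by ring⟩

/-- **Level `≥ 3`**: for `G ∈ p³·R`, `p³ ∣ 2G − G²` (`L_S ≡ 0 (mod p²)`). -/
theorem cube_dvd_truncLog_of_level_three (p g : R) :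
    p ^ 3 ∣ 2 * (p ^ 3 * g) - (p ^ 3 * g) ^ 2 :=
  ⟨2 * g - p ^ 3 * g ^ 2, by ring⟩

/-- **The coefficient arithmetic of (18.2).** If `2α = a₁` and `24β = 8(a₁² + a₂) + E₂` (i.e. `α = a₁/2`,
`β = c₂ = (a₁² + a₂)/3 + E₂/24`) then `24·(2β − α²) = 2·(5a₁² + 8a₂ + E₂)`, i.e. `β − α²/2 = (5a₁² + 8a₂ + E₂)/24`.
(`E₂` is a free ring element here; its meaning `E₂(E,ω)` and the Katz congruence are outside this file.) -/
theorem coeff_identity_E₂ (a₁ a₂ E₂ α β : R) (hα : 2 * α = a₁) (hβ : 24 * β = 8 * (a₁ ^ 2 + a₂) + E₂) :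
    24 * (2 * β - α ^ 2) = 2 * (5 * a₁ ^ 2 + 8 * a₂ + E₂) := by
  linear_combination 2 * hβ - (12 * α + 6 * a₁) * hα

/-- **(18.1)–(18.2) assembled at `k = 1`, everything multiplied through by `2·n′²`:** if
`n′²·H = 2·(L_U + L_S)` (`H = h_H(Q_K)/p`; the Mazur–Stein–Tate input), `2L_U ≡ −2F − 2pF + pF²` and
`2L_S ≡ 2α t₁ + p(2β − α²)t₁² (mod p²)`, then
`n′²·H ≡ (−2F − 2pF + pF²) + (2α t₁ + p(2β − α²) t₁²) (mod p²)` — THEOREM-candidate J's right-hand side, doubled. -/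
theorem sq_dvd_KHeight_second_order (p n' H L_U L_S F α β t₁ : R) (hH : n' ^ 2 * H = 2 * (L_U + L_S))
    (hU : p ^ 2 ∣ 2 * L_U - (-2 * F - 2 * p * F + p * F ^ 2))
    (hS : p ^ 2 ∣ 2 * L_S - (2 * α * t₁ + p * (2 * β - α ^ 2) * t₁ ^ 2)) :
    p ^ 2 ∣ n' ^ 2 * H - ((-2 * F - 2 * p * F + p * F ^ 2) + (2 * α * t₁ + p * (2 * β - α ^ 2) * t₁ ^ 2)) := by
  obtain ⟨c, hc⟩ := hU
  obtain ⟨d, hd⟩ := hS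
  exact ⟨c + d, by linear_combination hH + hc + hd⟩

/-! ### T18c — the reconstruction lemma 18.1 as linear algebra -/

/-- **Gram rearrangement (18.1(i)).** `Reg = h·h_o − s²` ⟹ `s² = h·h_o − Reg`. -/
theorem gram_offdiag_sq (h h_o s Reg : R) (hReg : Reg = h * h_o - s ^ 2) : s ^ 2 = h * h_o - Reg := by
  rw [hReg]; ring

/-- **Pole cancellation (18.1(iii)).** If the pole digits of `p·h(P)`, `p·h(P_o)`, `p·⟨P,P_o⟩` are `D`, `m²D`, `mD`
modulo `p` (the rank-one polar part `D·ℓ(X)ℓ(Y)` with `ℓ(P) = 1`, `ℓ(P_o) = m`), then the pole digit of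
`p·h(mP − P_o) = m²·(p h(P)) + p h(P_o) − 2m·(p⟨P,P_o⟩)` vanishes: `p ∣ m²A + A_o − 2mC`. -/
theorem dvd_pole_cancel (p D m A A_o C : R) (hA : p ∣ A - D) (hAo : p ∣ A_o - m ^ 2 * D) (hC : p ∣ C - m * D) :
    p ∣ m ^ 2 * A + A_o - 2 * m * C := by
  obtain ⟨a, ha⟩ := hA
  obtain ⟨b, hb⟩ := hAo
  obtain ⟨c, hc⟩ := hC
  exact ⟨m ^ 2 * a + b - 2 * m * c, by linear_combination m ^ 2 * ha + hb - 2 * m * hc⟩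

/-- **Polar form of a rank-one quadratic form (18.1(ii)).** For any additive `ℓ` (values `ℓX, ℓY, ℓXY` with
`ℓXY = ℓX + ℓY`) and any `D`: `D·ℓ(X+Y)² − D·ℓ(X)² − D·ℓ(Y)² = 2·(D·ℓ(X)·ℓ(Y))` — the polar form of `X ↦ D·ℓ(X)²` is
`(X,Y) ↦ D·ℓ(X)ℓ(Y)`. -/
theorem polar_rank_one (D ℓX ℓY ℓXY : R) (hadd : ℓXY = ℓX + ℓY) :
    D * ℓXY ^ 2 - D * ℓX ^ 2 - D * ℓY ^ 2 = 2 * (D * ℓX * ℓY) := by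
  rw [hadd]; ring

end Ring

section Bilinear

variable {R : Type*} [CommRing R] {M : Type*} [AddCommGroup M] [Module R M]

/-- **Reconstruction identity (18.1(iii)).** For a symmetric bilinear form `B` on an `R`-module and `Q = m•P − P_o`:
`B(Q,Q) = m²·B(P,P) + B(P_o,P_o) − 2m·B(P,P_o)` — `h_H(Q_K) = m²h_H(P) + h_H(P_o) − 2m·s` with `s = ⟨P,P_o⟩_H`. -/
theorem bilin_apply_smul_sub_self (B : M →ₗ[R] M →ₗ[R] R) (hB : ∀ x y, B x y = B y x) (m : R) (P P_o : M) :
    B (m • P - P_o) (m • P - P_o) = m ^ 2 * B P P + B P_o P_o - 2 * m * B P P_o := by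
  simp only [map_sub, map_smul, LinearMap.sub_apply, LinearMap.smul_apply, smul_eq_mul]
  rw [hB P_o P]
  ring

/-- **Polar form of the rank-one form on a module (18.1(ii)).** For a linear functional `ℓ` and a scalar `D`, the
bilinear map `(X,Y) ↦ D·ℓ(X)·ℓ(Y)` satisfies `D·ℓ(X+Y)² = D·ℓ(X)² + D·ℓ(Y)² + 2·D·ℓ(X)ℓ(Y)`; with `ℓ(P) = 1`,
`ℓ(P_o) = m` its values on `(P,P), (P_o,P_o), (P,P_o)` are `D, m²D, mD` — the pole digits used in `dvd_pole_cancel`. -/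
theorem polar_rank_one_module (ℓ : M →ₗ[R] R) (D : R) (X Y : M) :
    D * ℓ (X + Y) ^ 2 = D * ℓ X ^ 2 + D * ℓ Y ^ 2 + 2 * (D * ℓ X * ℓ Y) := by
  rw [map_add]; ring

/-- The three pole digits of the rank-one form at `(P,P)`, `(P_o,P_o)`, `(P,P_o)` when `ℓ(P) = 1`, `ℓ(P_o) = m`. -/
theorem rank_one_values (ℓ : M →ₗ[R] R) (D m : R) (P P_o : M) (hP : ℓ P = 1) (hPo : ℓ P_o = m) :
    D * ℓ P * ℓ P = D ∧ D * ℓ P_o * ℓ P_o = m ^ 2 * D ∧ D * ℓ P * ℓ P_o = m * D := by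
  refine ⟨?_, ?_, ?_⟩ <;> simp only [hP, hPo] <;> ring

end Bilinear

end Summit.BirchSwinnertonDyer.BirchSwinnertonDyer.Rank2Sha.Structure.KHeightSecondOrder
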